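import Summits.CriticalPhenomena.PercolationContinuityZ3.Theorems.Transplant.SkelFrmQuasiBParamsFramesF
import Summits.CriticalPhenomena.PercolationContinuityZ3.Theorems.Transplant.SkelFrmBParamsFramesF
import Summits.CriticalPhenomena.PercolationContinuityZ3.Theorems.Transplant.SkelFrmQuasiBParamsSlotsF
import Summits.CriticalPhenomena.PercolationContinuityZ3.Theorems.Transplant.SkelFrmBParamsSlotsF
import Summits.CriticalPhenomena.PercolationContinuityZ3.Theorems.Transplant.SkelNegBParamsFaceY
import Summits.CriticalPhenomena.PercolationContinuityZ3.Theorems.Transplant.PlanarSkeletonFrmQuasiDefs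
import Summits.CriticalPhenomena.PercolationContinuityZ3.Theorems.Transplant.PlanarSkeletonFrmDefs
import Summits.CriticalPhenomena.PercolationContinuityZ3.Theorems.Transplant.SkelPhiStepIDataNS
import Summits.CriticalPhenomena.PercolationContinuityZ3.Theorems.Transplant.SkelFrmQuasi1ParamsLBL
import Summits.CriticalPhenomena.PercolationContinuityZ3.Theorems.Transplant.SkelFrmQuasiBChoiceNums
import Summits.CriticalPhenomena.PercolationContinuityZ3.Theorems.Transplant.SkelFrmQuasiBParamsBridgeF
import Summits.CriticalPhenomena.PercolationContinuityZ3.Theorems.Transplant.SkelFrmQuasiBParamsLF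
import HarnessLib
import Summits.CriticalPhenomena.PercolationContinuityZ3.Theorems.Transplant.SkelFrmBParamsFramesF2
/-!
# GEN-Q PORT (WAVE-Q table v0.8 section 2, row G124, U-level L15; captain R-6/R-7 2026-08-27: carrier token swap `PlanarSkeletonFrmFrom ↦ PlanarSkeletonFrmQuasi`)
# of the tree module «Transplant/SkelFrmFromBParamsFramesF2» (sha256 576c6bd7d77c6273…) onto the quasi-step carrier `PlanarSkeletonFrmQuasi` (p507026): «SkelFrmQuasiBParamsFramesF2»

ORIGINAL TITLE: (F) VALUE LAYER, N2 twin (hp-8 g42, 2026-08-23; F-DISCHARGE-MAP-N2 G8/G18 origins, transposed cases): `port_frm.py` text of N1 `SkelNegBParamsFramesF2` (stmt-g16) over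

builds on p205010 (kernel theorem, internal audit signed; external expert review pending) — nothing in this file uses p205010; NOTHING is claimed about any open node
((N3-b), the end state).  Lane `prim-bschramm`, seat `prim-bschramm-p3` (gen 30; design owner; tool = captain gen-1 g4's port_genq.py R-14 --cone + p3-g30 slot-value patch T1).  Helper file (`--supports stmt-CriticalPhenomena-4575 --as helper`).
PORT RULES (U-wave r1–r4 re-used, GEN-Q hunk classes of p3-g29 #6136): declaration order, names and proof texts are those of «SkelFrmFromBParamsFramesF2», byte-identical except
(i) the carrier token `PlanarSkeletonFrmFrom ↦ PlanarSkeletonFrmQuasi` in binders, `namespace`/`end` lines and qualified names (module names `SkelFrmFrom… ↦ SkelFrmQuasi…`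
in imports of already-ported rows); (ii) `Φ.step ↦ Φ.qstep` with the called Steps lemma replaced by its `…Q`/`_q` twin and the cost `Φ.M` threaded (none in this file unless
listed below); (iii) `Φ.cyl_connected ↦ Φ.cyl_reach` readers (none unless listed); (iv) graph-ball radii / window floors ×`Φ.M` (none unless listed); (v) L-KitS-1 (design-owner ruling 2026-08-27): the (S0) kit data of «SkelFrmQuasiBChoiceNums» (stmt-g33, G017) are
N-parametrised — IN THIS FILE the readers `KS0.R'0/r₀0/r₀0_ge/base0/reach0 ↦ …N` resp. `KS.RA' ↦ KS.RAN'`, instantiated at `N := KS.NQ Φ = 13·max Φ.M 1`, nothing else.  Carrier-free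
residents stay imported/exported from the original «SkelFrmBParamsFramesF2» exactly as in the FrmFrom port.  Docstrings and citations are the original's.

-/

noncomputable section

open scoped Classical

namespace Summit.CriticalPhenomena.PercolationContinuityZ3.Theorems.Transplant

namespace PlanarSkeletonFrmQuasi

namespace NegB

open Literature.Probability.Percolation Literature.Probability.LatticeModels SimpleGraph
open SkelConc (Consts)
open Skelφ (shearUnit shearUnit_pos sgnz sgnz_cases)
open Skelφ.StepI (DataN)
open Neg

namespace KS

/-! ## §1 The two transposed cores at the wide pair, in coordinates -/

section Cores

-- GEN-Q (R-2, captain 2026-08-27): `PlanarSkeletonFrmFrom.NegB.KS.mem_core1F_side_iff` is not in the used cone of the node top — not ported.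

-- GEN-Q (R-2, captain 2026-08-27): `PlanarSkeletonFrmFrom.NegB.KS.mem_core1F_top_iff` is not in the used cone of the node top — not ported.

/-- `S_F = nBF + ℓBF + |hBF|` in `ℤ`. [folklore] -/
theorem SF_int (κ : Consts) {V : Type} [DecidableEq V] [Countable V] {G : SimpleGraph V} [G.LocallyFinite] (Φ : PlanarSkeletonFrmQuasi G) (t : V) (p : unitInterval) (D : Skelφ.StepI.DataNS V) (c : ℕ) (mk : ℕ) : ((SF κ Φ t p D c mk : ℕ) : ℤ) = (nBF κ Φ t p D c mk : ℤ) + ℓBF κ Φ t p D c mk + |hBF κ Φ t p D c mk| := by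
  unfold SF; push_cast [Int.natCast_natAbs]; ring

end Cores

/-! ## §2 The generic shifted origin and its two readings -/

section Generic

/-- **The y′-face origin at a core with frame-α range starting at `c_lo`, α-centre `c₀`, β-centre `b₁`, hop side `σh`, run sign `σ`**:
α := `σh·(c_lo + n_L) + σ·v_L`, β := `b₁ + ⌊σh·h_L·(c_lo + n_L − c₀ + σσh·v_L)/n_L⌋` (the core-centre origin of part FaceY in the `σh`-frame with the
shifted split `v′ := c_lo + n_L − c₀ + σσh·v_L`: a shift ALONG `u`, level-neutral). [this work] -/
def yLFof (κ : Consts) {V : Type} [DecidableEq V] [Countable V] {G : SimpleGraph V} [G.LocallyFinite] (Φ : PlanarSkeletonFrmQuasi G) (t : V) (p : unitInterval) (D : Skelφ.StepI.DataNS V) (g : ℕ) (f : ℕ) (σ σh clo c₀ b₁ : ℤ) : Site 2 :=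
  Skelφ.pt (σh * (clo + nL κ Φ t p D g f) + σ * vL κ Φ t p D g f)
    (b₁ + σh * hL κ Φ t p D g f * (clo + nL κ Φ t p D g f - c₀ + σ * σh * vL κ Φ t p D g f) / (nL κ Φ t p D g f : ℤ))

-- GEN-Q (R-2, captain 2026-08-27): `PlanarSkeletonFrmFrom.NegB.KS.yLFof_zero` is not in the used cone of the node top — not ported.

/-- `yLFof₀ = σh·(c₀ + v′)` and `yLFof₁ = b₁ + ⌊σh·h_L·v′/n_L⌋` with `v′ := c_lo + n_L − c₀ + σσh·v_L` (`σh = ±1`). [folklore] -/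
theorem yLFof_eq (κ : Consts) {V : Type} [DecidableEq V] [Countable V] {G : SimpleGraph V} [G.LocallyFinite] (Φ : PlanarSkeletonFrmQuasi G) (t : V) (p : unitInterval) (D : Skelφ.StepI.DataNS V) (g : ℕ) (f : ℕ) {σh : ℤ} (hσh : σh = 1 ∨ σh = -1) (σ clo c₀ b₁ : ℤ) :
    yLFof κ Φ t p D g f σ σh clo c₀ b₁ 0 = σh * (c₀ + (clo + nL κ Φ t p D g f - c₀ + σ * σh * vL κ Φ t p D g f)) ∧
      yLFof κ Φ t p D g f σ σh clo c₀ b₁ 1 = b₁ + σh * hL κ Φ t p D g f * (clo + nL κ Φ t p D g f - c₀ + σ * σh * vL κ Φ t p D g f) / (nL κ Φ t p D g f : ℤ) := by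
  have hσh2 : σh * σh = 1 := by rcases hσh with rfl | rfl <;> norm_num
  unfold yLFof; rw [Skelφ.pt_zero, Skelφ.pt_one]
  exact ⟨by linear_combination (-(σ * vL κ Φ t p D g f)) * hσh2, rfl⟩

-- GEN-Q (R-2, captain 2026-08-27): `PlanarSkeletonFrmFrom.NegB.KS.hxaF_of` is not in the used cone of the node top — not ported.

-- GEN-Q (R-2, captain 2026-08-27): `PlanarSkeletonFrmFrom.NegB.KS.hxbF_of` is not in the used cone of the node top — not ported.

end Generic

/-! ## §3 The two transposed origins at the wide pair and their readings -/

section Values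

/-- **THE y′-FACE ORIGIN AT THE WIDE BRIDGE, steep transposed case, hop side `σh`** (`c_lo := n_L − RA′ + |hBF|`, `c₀ := n_L + |hBF| + ℓBF/2`,
`b₁ := σh·(h_L + sgnz hBF·nBF) + ℓ_L/2`). [this work] -/
def yLFd (κ : Consts) {V : Type} [DecidableEq V] [Countable V] {G : SimpleGraph V} [G.LocallyFinite] (Φ : PlanarSkeletonFrmQuasi G) (t : V) (p : unitInterval) (D : Skelφ.StepI.DataNS V) (c : ℕ) (mk : ℕ) (g : ℕ) (f : ℕ) (σ σh : ℤ) : Site 2 :=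
  yLFof κ Φ t p D g f σ σh ((nL κ Φ t p D g f : ℤ) - KS0.R'0N κ Φ (KS.NQ Φ) t p D mk + |hBF κ Φ t p D c mk|)
    ((nL κ Φ t p D g f : ℤ) + |hBF κ Φ t p D c mk| + (ℓBF κ Φ t p D c mk : ℤ) / 2)
    (σh * (hL κ Φ t p D g f + sgnz (hBF κ Φ t p D c mk) * nBF κ Φ t p D c mk) + (ℓL κ Φ t p D g f : ℤ) / 2)

/-- **THE y′-FACE ORIGIN AT THE WIDE BRIDGE, flat transposed case, hop side `σh`** (`c_lo := n_L − RA′ + ℓBF − |hBF| − 11`, `c₀ := n_L + ℓBF − 5`,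
`b₁ := σh·h_L + ℓ_L/2`). [this work] -/
def yLFt (κ : Consts) {V : Type} [DecidableEq V] [Countable V] {G : SimpleGraph V} [G.LocallyFinite] (Φ : PlanarSkeletonFrmQuasi G) (t : V) (p : unitInterval) (D : Skelφ.StepI.DataNS V) (c : ℕ) (mk : ℕ) (g : ℕ) (f : ℕ) (σ σh : ℤ) : Site 2 :=
  yLFof κ Φ t p D g f σ σh ((nL κ Φ t p D g f : ℤ) - KS0.R'0N κ Φ (KS.NQ Φ) t p D mk + ((ℓBF κ Φ t p D c mk : ℤ) - |hBF κ Φ t p D c mk| - 11))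
    ((nL κ Φ t p D g f : ℤ) + ℓBF κ Φ t p D c mk - 5) (σh * hL κ Φ t p D g f + (ℓL κ Φ t p D g f : ℤ) / 2)

-- GEN-Q (R-2, captain 2026-08-27): `PlanarSkeletonFrmFrom.NegB.KS.yLFd_zero` is not in the used cone of the node top — not ported.

-- GEN-Q (R-2, captain 2026-08-27): `PlanarSkeletonFrmFrom.NegB.KS.yLFt_zero` is not in the used cone of the node top — not ported.

end Values

section At

-- GEN-Q (R-2, captain 2026-08-27): `PlanarSkeletonFrmFrom.NegB.KS.widthF_dt_le` is not in the used cone of the node top — not ported.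

-- GEN-Q (R-2, captain 2026-08-27): `PlanarSkeletonFrmFrom.NegB.KS.hxaF_d` is not in the used cone of the node top — not ported.

-- GEN-Q (R-2, captain 2026-08-27): `PlanarSkeletonFrmFrom.NegB.KS.hxbF_d` is not in the used cone of the node top — not ported.

-- GEN-Q (R-2, captain 2026-08-27): `PlanarSkeletonFrmFrom.NegB.KS.hxaF_t` is not in the used cone of the node top — not ported.

-- GEN-Q (R-2, captain 2026-08-27): `PlanarSkeletonFrmFrom.NegB.KS.hxbF_t` is not in the used cone of the node top — not ported.

end At

end KS

end NegB

end PlanarSkeletonFrmQuasi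

end Summit.CriticalPhenomena.PercolationContinuityZ3.Theorems.Transplant

end
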